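import Summits.ResolutionOfSingularities.ResolutionOfSingularities.Theorems.EquisingularLiftEquisingularLiftNatResidueHypDefsE11
import Summits.ResolutionOfSingularities.ResolutionOfSingularities.Theorems.EquisingularLiftEquisingularLiftCentreBlowupFlatExceptional
import Summits.ResolutionOfSingularities.ResolutionOfSingularities.Theorems.EquisingularLiftEquisingularLiftProjectiveAmbientSmoothProper
import Literature.AlgebraicGeometry.Resolution.RegularBlowup
import Literature.AlgebraicGeometry.Resolution.AlterationsLemma32
import HarnessLib

/-!
# EL♮(3) / EL♮(n), RUNG LC «large characteristic» — brick for (B3′)(s2) / (B5)(c1): OVER A REGULAR BASE THE DESCENT WORD NEEDS ONLY SMOOTH CENTRES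
# (`DescCentresSmoothOver s q ⇒ s.ExceptionalFlatOver q` when `Spec D` and `X` are regular), and the flatness-free constructor of `DescDoorAt`

leafhand-res-equisingularlift-3 g0 (prover, 2026-08-31; one-generation line-first hand on stmt-ResolutionOfSingularities-20148 / -20038 /
-15660, cell `pub/decomp-res`).  Crux `EquisingularLiftNatThree` (`stmt-…-20148`; uniform in `n`, so also `stmt-…-20038`), line W4.5(b), RUNG LC
(idea-2 g32 `Cruxes/EquisingularLiftNatThree/LARGE-CHAR-RUNG-idea2.md` v1.6 §(B3′)(s2) «every centre A-smooth ⇒ exceptionals A-flat», §(B5′)(c1)).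
The point-wise door ✓ `DescDoorAt B k θ n H ι` (…NatResidueHypDefsE11 :56) asks for a word `s : CentreSeq ℙⁿ_B` with TWO B-side clauses,
✓ `CentreSeq.ExceptionalFlatOver` (B-flat exceptional divisors — the clause that makes the word base-change, ✓ `isPullback_comap_of_exceptionalFlatOver`)
and ✓ `DescCentresSmoothOver` (B-smooth centres).  In RUNG LC the base `B = (ℤ[c]/𝔮)[1/(a a₀)]` is SMOOTH OVER `ℤ` after the (B4) shrink
(✓ `LargeChar.exists_formallySmooth_away_of_charZero`, …NatLargeCharSmoothBase), in particular a REGULAR Noetherian ring; this file proves, DEF-FREE,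
that over such a base the first clause FOLLOWS from the second, so that the spread `hspread` owes only the smooth-centres clause (and the k-fibre
clause `DescTransformOK`):

* `CentreSeq.exceptionalFlatOver_of_descCentresSmoothOver` — for `q : X ⟶ Spec D` with `D` Noetherian, `Spec D` regular, `X` regular and locally
  Noetherian: `DescCentresSmoothOver s q → s.ExceptionalFlatOver q`.  Step: a `D`-smooth centre is regular (✓ `Scheme.IsRegular.of_smooth`, EGA IV
  17.5.8 (iii)) and `D`-flat (Mathlib: smooth ⇒ flat), so the exceptional divisor of the blow-up along it is `D`-flat by the tree's ✓
  `flat_exceptional_of_isBlowup_regularCentre` (…CentreBlowupFlatExceptional, res-L1-w45b-stub-4: local quasi-regular presentation of a regular centre in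
  a regular scheme, `E = ℙ(normal bundle)` flat over the centre); the blown-up scheme is again regular (✓ `IsBlowup.isRegular_of_isRegular_subscheme`,
  Liu 8.1.19 (a)) and locally Noetherian, so the recursion continues.
* `isRegular_proj_of_isRegular_Spec` — `ℙⁿ_B` is regular when `Spec B` is (✓ `stub_projectiveAmbientSmoothProper`: `ℙⁿ_B → Spec B` smooth).
* ★ `descDoorAt_of_smoothCentres` — **the flatness-free constructor of the point-wise door**: for `B` Noetherian with `Spec B` regular, a word
  `s : CentreSeq ℙⁿ_B` with `DescCentresSmoothOver s q_B` and the k-fibre clause of `DescDoorAt` gives `DescDoorAt B k θ n H ι`.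

USE (RUNG LC only; nothing is specific to `n = 3`): (B5)(c1) «`ExceptionalFlatOver` / `DescCentresSmoothOver` = (s2)» — the first is now free over
the (B4) base; LC-SPREAD owes the spread of centre smoothness (s2) and the set-level fibre clauses (f1)–(f4) only.  Honest label: bookkeeping over
tree lemmas; `hspread` itself remains UNFUNDED; EL♮(3) NOT proved; EL♮ NOT proved; resolution of singularities in positive characteristic NOT proved;
nothing of [Hironaka2017] (a candidate under adjudication) is asserted or used.  [OURS · pure bookkeeping · standard axioms · DEF-FREE ·
`--supports stmt-ResolutionOfSingularities-20148 --as helper`, counted 0 · AI-written, weaker than expert review.]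
[cite: Grothendieck1967, Prop. 17.5.8 (iii)] [cite: Liu2002, Thm. 8.1.19 (a)] [cite: StacksProject, Tag 056P] (method; index only)
-/

set_option linter.dupNamespace false -- mandated namespace `Summit.<Summit>.<Problem>` of this single-conjunct summit

noncomputable section

open CategoryTheory CategoryTheory.Limits AlgebraicGeometry TopologicalSpace
open MvPolynomial
open Literature.AlgebraicGeometry.Resolution
open AlgebraicGeometry.Scheme.IdealSheafData
open Summit.ResolutionOfSingularities.ResolutionOfSingularities.Cruxes.EquisingularLift.StrataSplit

namespace Summit.ResolutionOfSingularities.ResolutionOfSingularities.Cruxes.EquisingularLiftNat.Sections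

section RegularBase

variable {D : Type} [CommRing D] [IsNoetherianRing D] (hD : Scheme.IsRegular (Spec (.of D)))

include hD

/-- **Over a regular base, smooth centres give flat exceptional divisors**: for `q : X ⟶ Spec D` with `D` Noetherian, `Spec D` regular and `X`
regular locally Noetherian, `DescCentresSmoothOver s q → s.ExceptionalFlatOver q` for every multiple blow-up `s` of `X`.  Step: the centre
`V(C) → Spec D` is smooth, hence `V(C)` is regular (✓ `Scheme.IsRegular.of_smooth`) and `D`-flat (Mathlib), so the exceptional divisor of `Bl_C X`
is `D`-flat (✓ `flat_exceptional_of_isBlowup_regularCentre`); `Bl_C X` is regular (✓ `IsBlowup.isRegular_of_isRegular_subscheme`) and locally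
Noetherian, and the rest of the word is treated over `Bl_C X → Spec D`.
[cite: Grothendieck1967, Prop. 17.5.8 (iii)] [cite: Liu2002, Thm. 8.1.19 (a)] [OURS · bookkeeping] -/
theorem CentreSeq.exceptionalFlatOver_of_descCentresSmoothOver :
    ∀ {X : Scheme.{0}} [IsLocallyNoetherian X] (_ : Scheme.IsRegular X) (s : CentreSeq X) (q : X ⟶ Spec (.of D)),
      DescCentresSmoothOver s q → s.ExceptionalFlatOver q
  | _, _, _, .nil _, _, _ => by simp
  | X, _, hX, .cons C rest, q, hsm => by
    haveI : Smooth (C.subschemeι ≫ q) := hsm.1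
    -- the centre is regular and flat over `Spec D`
    have hCreg : Scheme.IsRegular C.subscheme := Scheme.IsRegular.of_smooth (C.subschemeι ≫ q) hD
    have hCflat : Flat (C.subschemeι ≫ q) := inferInstance
    -- the exceptional divisor of `Bl_C X → Spec D` is flat
    have hexc : Flat ((C.comap (blowup.π C)).subschemeι ≫ blowup.π C ≫ q) :=
      flat_exceptional_of_isBlowup_regularCentre D X (blowup C) q C hX hCreg hCflat (blowup.π C) (blowup.isBlowup C)
    -- the blown-up scheme is regular and locally Noetherian
    haveI : IsProper (blowup.π C) := (blowup.isBlowup C).isProper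
    haveI : IsLocallyNoetherian (blowup C) := LocallyOfFiniteType.isLocallyNoetherian (blowup.π C)
    have hX' : Scheme.IsRegular (blowup C) := (blowup.isBlowup C).isRegular_of_isRegular_subscheme hX hCreg
    rw [CentreSeq.exceptionalFlatOver_cons]
    exact ⟨hexc, CentreSeq.exceptionalFlatOver_of_descCentresSmoothOver hX' rest (blowup.π C ≫ q) hsm.2⟩

end RegularBase

section Door

/-- `ℙⁿ_B` is regular (and locally Noetherian) when `Spec B` is regular and `B` is Noetherian: `ℙⁿ_B → Spec B` is smooth
(✓ `stub_projectiveAmbientSmoothProper`) and ✓ `Scheme.IsRegular.of_smooth`. [cite: Grothendieck1967, Prop. 17.5.8 (iii)] [OURS · bookkeeping] -/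
theorem isRegular_proj_of_isRegular_Spec (B : Type) [CommRing B] [IsNoetherianRing B] (hB : Scheme.IsRegular (Spec (.of B))) (n : ℕ) :
    letI := MvPolynomial.gradedAlgebra (σ := Fin (n + 1)) (R := B)
    IsLocallyNoetherian (Proj (homogeneousSubmodule (Fin (n + 1)) B)) ∧
      Scheme.IsRegular (Proj (homogeneousSubmodule (Fin (n + 1)) B)) := by
  letI := MvPolynomial.gradedAlgebra (σ := Fin (n + 1)) (R := B)
  obtain ⟨hsm, -⟩ := stub_projectiveAmbientSmoothProper B n
  haveI := hsm
  exact ⟨LocallyOfFiniteType.isLocallyNoetherian (Proj.toSpecZero (homogeneousSubmodule (Fin (n + 1)) B) ≫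
      Spec.map (CommRingCat.ofHom (algebraMap B (homogeneousSubmodule (Fin (n + 1)) B 0)))),
    Scheme.IsRegular.of_smooth (Proj.toSpecZero (homogeneousSubmodule (Fin (n + 1)) B) ≫
      Spec.map (CommRingCat.ofHom (algebraMap B (homogeneousSubmodule (Fin (n + 1)) B 0)))) hB⟩

/-- ★ **`descDoorAt_of_smoothCentres` — the flatness-free constructor of the point-wise descent door over a regular Noetherian base** (RUNG LC
(B4)/(B5)(c1): `B = (ℤ[c]/𝔮)[1/(a a₀)]` smooth over `ℤ`): a word `s : CentreSeq ℙⁿ_B` with `B`-SMOOTH centres whose k-fibres at the graded lifts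
of `θ` are embedded resolution words (`DescTransformOK`, the door's own clause verbatim) IS a certificate `DescDoorAt B k θ n H ι` — the `B`-flatness of
the exceptional divisors is supplied by `CentreSeq.exceptionalFlatOver_of_descCentresSmoothOver` on the regular `ℙⁿ_B` (`isRegular_proj_of_isRegular_Spec`).
[cite: Grothendieck1967, Prop. 17.5.8 (iii)] [cite: Liu2002, Thm. 8.1.19 (a)] [OURS · L1 W4.5b · RUNG LC bookkeeping; EL♮(3) NOT proved] -/
theorem descDoorAt_of_smoothCentres (B : Type) [CommRing B] [IsNoetherianRing B] (hB : Scheme.IsRegular (Spec (.of B)))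
    (k : Type) [Field k] (θ : B →+* k) (n : ℕ) (H : AlgebraicGeometry.Scheme.{0})
    (ι : H ⟶ (Literature.AlgebraicGeometry.Motives.projectiveSpace n k).left)
    (s : letI := MvPolynomial.gradedAlgebra (σ := Fin (n + 1)) (R := B)
      CentreSeq (AlgebraicGeometry.Proj (MvPolynomial.homogeneousSubmodule (Fin (n + 1)) B)))
    (hCS : letI := MvPolynomial.gradedAlgebra (σ := Fin (n + 1)) (R := B)
      DescCentresSmoothOver s
        (AlgebraicGeometry.Proj.toSpecZero (MvPolynomial.homogeneousSubmodule (Fin (n + 1)) B) ≫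
          AlgebraicGeometry.Spec.map (CommRingCat.ofHom (algebraMap B (MvPolynomial.homogeneousSubmodule (Fin (n + 1)) B 0)))))
    (hTOK : letI := MvPolynomial.gradedAlgebra (σ := Fin (n + 1)) (R := B)
      letI := MvPolynomial.gradedAlgebra (σ := Fin (n + 1)) (R := k)
      ∀ (φ : MvPolynomial.homogeneousSubmodule (Fin (n + 1)) B →+*ᵍ MvPolynomial.homogeneousSubmodule (Fin (n + 1)) k)
        (hφ' : HomogeneousIdeal.irrelevant (MvPolynomial.homogeneousSubmodule (Fin (n + 1)) k) ≤
          (HomogeneousIdeal.irrelevant (MvPolynomial.homogeneousSubmodule (Fin (n + 1)) B)).map φ),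
        (∀ t, φ t = MvPolynomial.map θ t) →
        IsPullback (AlgebraicGeometry.Proj.map φ hφ' :
              (Literature.AlgebraicGeometry.Motives.projectiveSpace n k).left ⟶ AlgebraicGeometry.Proj (MvPolynomial.homogeneousSubmodule (Fin (n + 1)) B))
            (AlgebraicGeometry.Proj.toSpecZero (MvPolynomial.homogeneousSubmodule (Fin (n + 1)) k) ≫
              AlgebraicGeometry.Spec.map (CommRingCat.ofHom (algebraMap k (MvPolynomial.homogeneousSubmodule (Fin (n + 1)) k 0))))
            (AlgebraicGeometry.Proj.toSpecZero (MvPolynomial.homogeneousSubmodule (Fin (n + 1)) B) ≫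
              AlgebraicGeometry.Spec.map (CommRingCat.ofHom (algebraMap B (MvPolynomial.homogeneousSubmodule (Fin (n + 1)) B 0))))
            (AlgebraicGeometry.Spec.map (CommRingCat.ofHom θ)) →
        DescTransformOK (s.comap (AlgebraicGeometry.Proj.map φ hφ' :
              (Literature.AlgebraicGeometry.Motives.projectiveSpace n k).left ⟶ AlgebraicGeometry.Proj (MvPolynomial.homogeneousSubmodule (Fin (n + 1)) B)))
          (𝟙 (Literature.AlgebraicGeometry.Motives.projectiveSpace n k).left) (Set.range ι) (Set.range ι)) :
    DescDoorAt B k θ n H ι := by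
  letI := MvPolynomial.gradedAlgebra (σ := Fin (n + 1)) (R := B)
  letI := MvPolynomial.gradedAlgebra (σ := Fin (n + 1)) (R := k)
  obtain ⟨hnoeth, hreg⟩ := isRegular_proj_of_isRegular_Spec B hB n
  haveI := hnoeth
  exact ⟨s, CentreSeq.exceptionalFlatOver_of_descCentresSmoothOver hB hreg s _ hCS, hCS, hTOK⟩

end Door

end Summit.ResolutionOfSingularities.ResolutionOfSingularities.Cruxes.EquisingularLiftNat.Sections

end
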